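import Summits.MatrixMultiplication.MatrixMultiplication.Theorems.FarEdgeDescentSmoothWorlds
import HarnessLib

set_option linter.dupNamespace false

noncomputable section

namespace Summit.MatrixMultiplication.MatrixMultiplication.Theorems.FarEdgeDescentSpectralAudit

open Summit.MatrixMultiplication.MatrixMultiplication.Theorems.FarEdgeDescentSmoothWorlds (tangentialWorld)
open Filter Topology Set

/-!
# FarEdgeDescent — AUDIT of the lineage's 1D worlds against the 2D laws; ERRATUM for the parabola
# template; the repaired (ARC) template

Companion of `FarEdgeDescentSpectralWorlds` (gen 24, lens «structural dichotomy»).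

The 1D model worlds of gens 17–23 were certified against the pencil laws only (convexity, floor `f ≥ 2`,
`f ≥ x+1`, 1-Lipschitz).  Two typed 2D laws relate DIFFERENT shapes of the pencil: the FOLD
(`FarEdgeDescentAlphaPrice.dualDefect_le_excess`) and the CUBE LINE
`(K+2)·ω ≤ 3·ω(1,K,1)` (`FarEdgeDescentCornerFold.sum_mul_omega_le_three_mul_omegaRect`: 3D symmetrisation
`ω(x,y,z)+ω(y,z,x)+ω(z,x,y) ≥ (x+y+z)·ω`), whose excess form `e(K) ≥ (ω−2) − (K−1)(3−ω)/3` is THREE times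
sharper than the 1D anchor line `e(K) ≥ (ω−2) − (K−1)(3−ω)` (`FarEdgeDescentExpFloor.anchorLine_le_excess`).
Read as whole profiles, gen 21's `tangentialWorld` and `darkVertexWorld` VIOLATE the cube line (below), and the
gen-23 near parabola `2 + (x−½)₊²` admits NO amortising convex extension at all (left slope `1` at the square):
ERRATUM to `FarEdgeDescentNearWorlds` — its near-edge facts stand, its use as the near edge of a lawful world
does not; the repaired template is `2 + (x−½)₊²/2`, realised (with far edge `x+1+(3−x)₊²/(16(x+1))`, landing
TANGENTIALLY at `3`) by the 3D arc world `conv(T ∪ S₃·{(1−v/4−v²/4, v, 1−v/4−v²/4) : 0 ≤ v ≤ ½})` — the 1D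
certificate is `arcTemplate` below, the 3D realisation is recorded in the gen-24 memo. -/

/-- AUDIT: gen 21's `tangentialWorld` profile violates the cube line at `K = 3/2`. -/
theorem tangentialWorld_violates_cubeLine :
    ¬ ∀ K : ℝ, 1 ≤ K → (K + 2) * (fun x : ℝ => x + 1 + max (2 - x) 0 ^ 2 / 4) 1 ≤
      3 * (fun x : ℝ => x + 1 + max (2 - x) 0 ^ 2 / 4) K := by
  intro h
  have h1 := h (3 / 2) (by norm_num)
  norm_num [max_def] at h1

/-- AUDIT: gen 21's `darkVertexWorld` profile (`ω_W = 3`) violates the cube line at `K = 3/2`. -/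
theorem darkVertexWorld_violates_cubeLine :
    ¬ ∀ K : ℝ, 1 ≤ K → (K + 2) * (fun x : ℝ => x + 1 + max (2 - x) 0) 1 ≤
      3 * (fun x : ℝ => x + 1 + max (2 - x) 0) K := by
  intro h
  have h1 := h (3 / 2) (by norm_num)
  norm_num [max_def] at h1

/-- ★ ERRATUM (gen 23 `nearParabolaWorld`): NO convex function on `[0,∞)` that equals the parabola template
`2 + (x − ½)₊²` on `[0,1]` is amortising — its excess over `x+1` is at least `1/4` at every far shape (the
template reaches the square with slope `1`, so convexity forces `G(k) ≥ k + 5/4`).  In particular no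
3D-lawful world has this near edge. -/
theorem parabolaTemplate_no_amortising_extension (G : ℝ → ℝ) (hG : ConvexOn ℝ (Ici 0) G)
    (hnear : ∀ x : ℝ, 0 ≤ x → x ≤ 1 → G x = 2 + max (x - 1 / 2) 0 ^ 2) :
    (∀ k : ℝ, 1 ≤ k → k + 5 / 4 ≤ G k) ∧ ¬ Tendsto (fun k : ℝ => G k - (k + 1)) atTop (𝓝 0) := by
  have hG1 : G 1 = 9 / 4 := by rw [hnear 1 (by norm_num) le_rfl]; norm_num [max_def]
  have main : ∀ k : ℝ, 1 ≤ k → k + 5 / 4 ≤ G k := by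
    intro k hk
    rcases eq_or_lt_of_le hk with rfl | hk1
    · rw [hG1]; norm_num
    refine le_of_forall_pos_le_add fun ε hε => ?_
    have hk0 : 0 < k := by linarith
    set h := min (1 / 2) (ε / k) with hdef
    have hh0 : 0 < h := lt_min (by norm_num) (div_pos hε hk0)
    have hh1 : h ≤ 1 / 2 := min_le_left _ _
    have hhε : h ≤ ε / k := min_le_right _ _
    have hGh : G (1 - h) = 2 + (1 / 2 - h) ^ 2 := by
      rw [hnear (1 - h) (by linarith) (by linarith), max_eq_left (by linarith)]
      ring
    have s := hG.slope_mono_adjacent (x := 1 - h) (y := 1) (z := k)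
      (mem_Ici.2 (by linarith)) (mem_Ici.2 (by linarith)) (by linarith) hk1
    rw [hG1, hGh, show (1 : ℝ) - (1 - h) = h by ring,
      show ((9 / 4 : ℝ) - (2 + (1 / 2 - h) ^ 2)) / h = 1 - h by field_simp; ring,
      le_div_iff₀ (by linarith)] at s
    have hkh : (k - 1) * h ≤ ε := by
      calc (k - 1) * h ≤ (k - 1) * (ε / k) := mul_le_mul_of_nonneg_left hhε (by linarith)
        _ ≤ k * (ε / k) := mul_le_mul_of_nonneg_right (by linarith) (div_pos hε hk0).le
        _ = ε := by field_simp
    nlinarith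
  refine ⟨main, fun hT => ?_⟩
  have ev := hT.eventually (Iio_mem_nhds (show (0 : ℝ) < 1 / 4 by norm_num))
  obtain ⟨k, hk1, hk2⟩ := ((eventually_ge_atTop (1 : ℝ)).and ev).exists
  have h1 := main k hk1
  have h2 : G k - (k + 1) < 1 / 4 := hk2
  linarith

/-- ★ THE ARC TEMPLATE (repaired tangential world, 1D certificate).  Near edge `n(x) = 2 + (x−½)₊²/2`, far
edge `φ(x) = x + 1 + (3−x)₊²/(16(x+1))`: they meet at the square (`ω_W = 17/8`); `φ` is saturated exactly from
`3` on and lands TANGENTIALLY (differentiable at every `x > 1`: `SmoothProfile`-shape), violates the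
`AnchoredLogConvexity`-shape (at `m = 2`), RESPECTS the cube line (equality at `K = 1`), and near/far are
FOLD-EXACT: `n(x) − 2 = x·(φ(2/x − 1) − 2/x)` on `(0,1]`.  So (`FiniteSaturation`, `SmoothProfile`, `N3`,
`W3`, fold-tight) is realised — the lawful replacement of gen 21's `tangentialWorld`. -/
theorem arcTemplate :
    ((fun x : ℝ => x + 1 + max (3 - x) 0 ^ 2 / (16 * (x + 1))) 1 = 17 / 8 ∧
      (fun x : ℝ => 2 + max (x - 1 / 2) 0 ^ 2 / 2) 1 = 17 / 8) ∧
    ((fun x : ℝ => x + 1 + max (3 - x) 0 ^ 2 / (16 * (x + 1))) 3 = 3 + 1 ∧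
      ∀ x : ℝ, 1 ≤ x → x < 3 → x + 1 < (fun x : ℝ => x + 1 + max (3 - x) 0 ^ 2 / (16 * (x + 1))) x) ∧
    (∀ x : ℝ, 1 < x → DifferentiableAt ℝ (fun x : ℝ => x + 1 + max (3 - x) 0 ^ 2 / (16 * (x + 1))) x) ∧
    ¬ (∀ m : ℝ, 1 < m →
      ((fun x : ℝ => x + 1 + max (3 - x) 0 ^ 2 / (16 * (x + 1))) m - (m + 1)) ^ 2 ≤
        ((fun x : ℝ => x + 1 + max (3 - x) 0 ^ 2 / (16 * (x + 1))) 1 - 2) *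
          ((fun x : ℝ => x + 1 + max (3 - x) 0 ^ 2 / (16 * (x + 1))) (2 * m - 1) - 2 * m)) ∧
    (∀ K : ℝ, 1 ≤ K → (K + 2) * (fun x : ℝ => x + 1 + max (3 - x) 0 ^ 2 / (16 * (x + 1))) 1 ≤
      3 * (fun x : ℝ => x + 1 + max (3 - x) 0 ^ 2 / (16 * (x + 1))) K) ∧
    (∀ x : ℝ, 0 < x → x ≤ 1 → (fun x : ℝ => 2 + max (x - 1 / 2) 0 ^ 2 / 2) x - 2 =
      x * ((fun x : ℝ => x + 1 + max (3 - x) 0 ^ 2 / (16 * (x + 1))) (2 / x - 1) - 2 / x)) := by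
  refine ⟨⟨by norm_num [max_def], by norm_num [max_def]⟩, ⟨by norm_num [max_def], fun x hx1 hx3 => ?_⟩,
    fun x hx => ?_, fun h => ?_, fun K hK => ?_, fun x hx0 hx1 => ?_⟩
  · try simp only
    rw [max_eq_left (by linarith : 0 ≤ 3 - x)]
    have : 0 < (3 - x) ^ 2 / (16 * (x + 1)) := by
      apply div_pos (by nlinarith) (by linarith)
    linarith
  · have key : (fun y : ℝ => max (3 - y) 0 ^ 2) =
        fun y : ℝ => 4 * ((fun x : ℝ => x + 1 + max (2 - x) 0 ^ 2 / 4) (y - 1) - y) := by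
      funext y
      try simp only
      rw [show (2 : ℝ) - (y - 1) = 3 - y by ring]
      ring
    have hd : DifferentiableAt ℝ (fun y : ℝ => max (3 - y) 0 ^ 2) x := by
      rw [key]
      exact (((tangentialWorld.2.2.1 (x - 1)).comp x (differentiableAt_id.sub_const 1)).sub
        differentiableAt_id).const_mul 4
    have hx1 : 16 * (x + 1) ≠ 0 := by positivity
    exact (by fun_prop : DifferentiableAt ℝ (fun y : ℝ => y + 1) x).add (hd.div (by fun_prop) hx1)
  · have h2 := h 2 (by norm_num)
    norm_num [max_def] at h2
  · try simp only
    rw [max_eq_left (by norm_num : (0 : ℝ) ≤ 3 - 1)]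
    rcases le_total K 3 with h3 | h3
    · rw [max_eq_left (by linarith : 0 ≤ 3 - K)]
      have hK1 : 0 < 16 * (K + 1) := by linarith
      have key : 3 * (K + 1 + (3 - K) ^ 2 / (16 * (K + 1))) - (K + 2) * (1 + 1 + (3 - 1) ^ 2 / (16 * (1 + 1)))
          = (17 * K - 7) * (K - 1) / (16 * (K + 1)) := by
        field_simp
        ring
      have hnn : 0 ≤ (17 * K - 7) * (K - 1) / (16 * (K + 1)) :=
        div_nonneg (by nlinarith) hK1.le
      linarith
    · rw [max_eq_right (by linarith : 3 - K ≤ 0)]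
      norm_num
      linarith
  · try simp only
    have hk : 1 ≤ 2 / x - 1 := by
      rw [le_sub_iff_add_le, le_div_iff₀ hx0]; linarith
    have hxp : 16 * (2 / x - 1 + 1) = 32 / x := by ring
    rw [hxp]
    rcases le_total x (1 / 2) with h | h
    · have h3 : 3 - (2 / x - 1) ≤ 0 := by
        rw [sub_nonpos, le_sub_iff_add_le, le_div_iff₀ hx0]; linarith
      rw [max_eq_right (by linarith : x - 1 / 2 ≤ 0), max_eq_right h3]
      field_simp
      ring
    · have h3 : 0 ≤ 3 - (2 / x - 1) := by
        rw [sub_nonneg, sub_le_iff_le_add, div_le_iff₀ hx0]; linarith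
      rw [max_eq_left (by linarith : 0 ≤ x - 1 / 2), max_eq_left h3]
      field_simp
      ring



end Summit.MatrixMultiplication.MatrixMultiplication.Theorems.FarEdgeDescentSpectralAudit
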